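import Literature.AlgebraicGeometry.Motives.ThickeningSpecOver
import HarnessLib

/-!
# Artinian points factor through the thickenings `Spec(𝒪_{T,x}/𝔪^{n+1})`

For a scheme `T → Spec K` over a field `K`, a point `x` (conventions of `Motives/ThickeningTower` and
`Motives/ThickeningSpecOver`) and a LOCAL commutative `K`-algebra `R` with `𝔪_R^{n+1} = 0`:

* `stalkHomOfPt` — the local ring map `𝒪_{T,x} → R` of an `R`-point `g : Spec R → T` centred at `x`
  (Mathlib `Scheme.stalkClosedPointTo`, transported along `g(𝔪_R) = x`), `Spec_map_stalkHomOfPt`;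
* **`artinianFactor`** — the `K`-algebra map `𝒪_{T,x}/𝔪^{n+1} → R` through which `g` factors
  (`Spec_map_artinianFactor : Spec φ_g ≫ (Spec(𝒪/𝔪^{n+1}) → T) = g`, `artinianFactorOver`), and its
  UNIQUENESS `artinianFactor_unique` (Mathlib `SpecToEquivOfLocalRing`), with the extensionality of chart
  points `algHom_thickRing_ext` (two `K`-algebra maps `𝒪_{T,x}/𝔪^{n+1} → R` with the same `R`-point agree);
* the levels are admissible `R`'s themselves: `isLocalRing_thickRing`, `maximalIdeal_thickRing`,
  `maximalIdeal_thickRing_pow_eq_bot`, `isLocalHom_thickπ`, `Spec_map_thickπ_closedPoint`.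

These are the «chart points at level `n`» (morphisms `Spec(𝒪_{T,t}/𝔪^{n+1}) → Spec(𝒪_{Â,y}/𝔪^{n+1})`) of
infinitesimal lifting arguments over local Artinian quotients (Görtz–Wedhorn II, Lemma 24.72 and its proof;
the small-extension lifting diagram of Prop. 27.208). Everything is proved; no named facts. Mathlib searched
(pin): `Scheme.stalkClosedPointTo`, `Scheme.Spec_stalkClosedPointTo_fromSpecStalk`,
`Scheme.SpecMap_stalkSpecializes_fromSpecStalk`, `SpecToEquivOfLocalRing`, `Ideal.Quotient.liftₐ`,
`IsLocalRing.of_surjective'`, `map_maximalIdeal_of_surjective`, `Spec_closedPoint` (used).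

## References

* The Stacks Project, Tag 01J6 (Schemes, Lemma 26.13.1: points with values in a local ring). [StacksProject]
* U. Görtz, T. Wedhorn, *Algebraic Geometry II: Cohomology of Schemes*, Springer Spektrum (2023),
  doi:10.1007/978-3-658-43031-3: Lemma 24.72 (p. 409), proof, Steps (I)–(II) (p. 410); Prop. 27.208 (p. 685).
  [GortzWedhorn2023]
-/

universe u

open CategoryTheory CategoryTheory.Limits AlgebraicGeometry TopologicalSpace Opposite
open TensorProduct IsLocalRing
open Literature.AlgebraicGeometry.Morphisms

noncomputable section

namespace Literature.AlgebraicGeometry.Motives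

/-! ## §4 (α7) Artinian points factor through the thickenings `Spec(𝒪_{T,x}/𝔪^{n+1})` -/

section ArtinianPoints

variable {K : Type u} [Field K] (T : SchemeOver K) {B : T.left.Opens} (x : B)
  {R : Type u} [CommRing R] [IsLocalRing R]

/-- **The local ring map `𝒪_{T,x} → R` of an `R`-point `g : Spec R → T` centred at `x`** (`R` local,
`g (closed point) = x`): Mathlib's `Scheme.stalkClosedPointTo g` transported from `𝒪_{T, g(𝔪_R)}` to
`𝒪_{T,x}` along `g(𝔪_R) = x` (`stalkSpecializes`). [cite: StacksProject, Tag 01J6 (Schemes, Lemma 26.13.1)] -/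
def stalkHomOfPt (g : Spec (CommRingCat.of R) ⟶ T.left) (hg : g (closedPoint R) = x.1) :
    T.left.presheaf.stalk x.1 ⟶ CommRingCat.of R :=
  T.left.presheaf.stalkSpecializes (specializes_of_eq hg) ≫ Scheme.stalkClosedPointTo g

/-- `Spec(𝒪_{T,x} → R) ≫ (Spec 𝒪_{T,x} → T) = g` (Mathlib `Spec_stalkClosedPointTo_fromSpecStalk`,
`SpecMap_stalkSpecializes_fromSpecStalk`). [cite: StacksProject, Tag 01J6 (Schemes, Lemma 26.13.1)] -/
theorem Spec_map_stalkHomOfPt (g : Spec (CommRingCat.of R) ⟶ T.left) (hg : g (closedPoint R) = x.1) :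
    Spec.map (stalkHomOfPt T x g hg) ≫ T.left.fromSpecStalk x.1 = g := by
  rw [stalkHomOfPt, Spec.map_comp, Category.assoc, Scheme.SpecMap_stalkSpecializes_fromSpecStalk,
    Scheme.Spec_stalkClosedPointTo_fromSpecStalk]

/-- The map `𝒪_{T,x} → R` of a centred `R`-point is a local homomorphism. [cite: StacksProject, Tag 01J6 (Schemes, Lemma 26.13.1)] -/
theorem isLocalHom_stalkHomOfPt (g : Spec (CommRingCat.of R) ⟶ T.left) (hg : g (closedPoint R) = x.1) :
    IsLocalHom (stalkHomOfPt T x g hg).hom := by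
  have key : ∀ {y : T.left} (h : y = x.1),
      IsLocalHom (T.left.presheaf.stalkSpecializes (specializes_of_eq h)).hom := by
    rintro _ rfl
    rw [TopCat.Presheaf.stalkSpecializes_refl]
    exact ⟨fun a ha => ha⟩
  haveI := key hg
  change IsLocalHom ((Scheme.stalkClosedPointTo g).hom.comp
    (T.left.presheaf.stalkSpecializes (specializes_of_eq hg)).hom)
  infer_instance

/-- A centred `R`-point with `𝔪_R^{n+1} = 0` kills `𝔪_x^{n+1}`. [cite: StacksProject, Tag 01J6 (Schemes, Lemma 26.13.1)] [cite: GortzWedhorn2023, Prop. 27.208 (p. 685)] -/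
theorem pow_maximalIdeal_le_ker_stalkHomOfPt (g : Spec (CommRingCat.of R) ⟶ T.left)
    (hg : g (closedPoint R) = x.1) (n : ℕ) (hR : maximalIdeal R ^ (n + 1) = ⊥) :
    maximalIdeal (stalkAt T x) ^ (n + 1) ≤ RingHom.ker (stalkHomOfPt T x g hg).hom := by
  haveI := isLocalHom_stalkHomOfPt T x g hg
  rw [RingHom.ker_eq_comap_bot, ← Ideal.map_le_iff_le_comap, Ideal.map_pow, ← hR]
  exact Ideal.pow_right_mono (map_maximalIdeal_le _) _

variable [Algebra K R]

/-- For a `K`-morphism `g : Spec R → T` (`g ≫ (T → Spec K) = Spec (K → R)`) the map `𝒪_{T,x} → R`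
intertwines the `K`-structures (through `Spec_map_algebraMap_stalkAt` and faithfulness of `Spec`).
[cite: StacksProject, Tag 01J6 (Schemes, Lemma 26.13.1)] -/
theorem ofHom_algebraMap_comp_stalkHomOfPt (g : Spec (CommRingCat.of R) ⟶ T.left)
    (hg : g (closedPoint R) = x.1) (hgK : g ≫ T.hom = Spec.map (CommRingCat.ofHom (algebraMap K R))) :
    CommRingCat.ofHom (algebraMap K (stalkAt T x)) ≫ stalkHomOfPt T x g hg =
      CommRingCat.ofHom (algebraMap K R) := by
  apply Spec.map_injective
  rw [Spec.map_comp, Spec_map_algebraMap_stalkAt, ← Category.assoc, Spec_map_stalkHomOfPt, hgK]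

/-- The map `𝒪_{T,x} → R` of a centred `K`-rational `R`-point is `K`-linear. [cite: StacksProject, Tag 01J6 (Schemes, Lemma 26.13.1)] -/
theorem stalkHomOfPt_algebraMap (g : Spec (CommRingCat.of R) ⟶ T.left) (hg : g (closedPoint R) = x.1)
    (hgK : g ≫ T.hom = Spec.map (CommRingCat.ofHom (algebraMap K R))) (c : K) :
    (stalkHomOfPt T x g hg).hom (algebraMap K (stalkAt T x) c) = algebraMap K R c := by
  have h := congrArg CommRingCat.Hom.hom (ofHom_algebraMap_comp_stalkHomOfPt T x g hg hgK)
  rw [CommRingCat.hom_comp, CommRingCat.hom_ofHom, CommRingCat.hom_ofHom] at h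
  exact RingHom.congr_fun h c

/-- `𝒪_{T,x} → R` as a `K`-algebra homomorphism. [cite: StacksProject, Tag 01J6 (Schemes, Lemma 26.13.1)] -/
def stalkAlgHomOfPt (g : Spec (CommRingCat.of R) ⟶ T.left) (hg : g (closedPoint R) = x.1)
    (hgK : g ≫ T.hom = Spec.map (CommRingCat.ofHom (algebraMap K R))) : stalkAt T x →ₐ[K] R :=
  ⟨(stalkHomOfPt T x g hg).hom, stalkHomOfPt_algebraMap T x g hg hgK⟩

/-- Unfolding of `stalkAlgHomOfPt`. [cite: StacksProject, Tag 01J6 (Schemes, Lemma 26.13.1)] -/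
@[simp] theorem stalkAlgHomOfPt_apply (g : Spec (CommRingCat.of R) ⟶ T.left)
    (hg : g (closedPoint R) = x.1) (hgK : g ≫ T.hom = Spec.map (CommRingCat.ofHom (algebraMap K R)))
    (r : stalkAt T x) : stalkAlgHomOfPt T x g hg hgK r = (stalkHomOfPt T x g hg).hom r :=
  rfl

/-- **(α7) THE ARTINIAN FACTORISATION**: a `K`-morphism `g : Spec R → T` from a local `K`-algebra `R`
with `𝔪_R^{n+1} = 0`, centred at `x`, gives the `K`-algebra map `φ_g : 𝒪_{T,x}/𝔪_x^{n+1} → R`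
(Mathlib `Ideal.Quotient.liftₐ`). [cite: StacksProject, Tag 01J6 (Schemes, Lemma 26.13.1)] [cite: GortzWedhorn2023, Prop. 27.208 (p. 685)] -/
def artinianFactor (g : Spec (CommRingCat.of R) ⟶ T.left) (hg : g (closedPoint R) = x.1)
    (hgK : g ≫ T.hom = Spec.map (CommRingCat.ofHom (algebraMap K R))) (n : ℕ)
    (hR : maximalIdeal R ^ (n + 1) = ⊥) : thickRing T x n →ₐ[K] R :=
  Ideal.Quotient.liftₐ _ (stalkAlgHomOfPt T x g hg hgK) fun _ ha =>
    pow_maximalIdeal_le_ker_stalkHomOfPt T x g hg n hR ha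

/-- `φ_g` on residue classes. [cite: StacksProject, Tag 01J6 (Schemes, Lemma 26.13.1)] [cite: GortzWedhorn2023, Prop. 27.208 (p. 685)] -/
@[simp] theorem artinianFactor_mk (g : Spec (CommRingCat.of R) ⟶ T.left) (hg : g (closedPoint R) = x.1)
    (hgK : g ≫ T.hom = Spec.map (CommRingCat.ofHom (algebraMap K R))) (n : ℕ)
    (hR : maximalIdeal R ^ (n + 1) = ⊥) (r : stalkAt T x) :
    artinianFactor T x g hg hgK n hR (Ideal.Quotient.mk _ r) = (stalkHomOfPt T x g hg).hom r :=
  rfl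

/-- `φ_g ∘ (𝒪 → 𝒪/𝔪^{n+1}) = (𝒪_{T,x} → R)` as ring maps in `CommRingCat`. [cite: StacksProject, Tag 01J6 (Schemes, Lemma 26.13.1)] [cite: GortzWedhorn2023, Prop. 27.208 (p. 685)] -/
theorem mk_comp_artinianFactor (g : Spec (CommRingCat.of R) ⟶ T.left) (hg : g (closedPoint R) = x.1)
    (hgK : g ≫ T.hom = Spec.map (CommRingCat.ofHom (algebraMap K R))) (n : ℕ)
    (hR : maximalIdeal R ^ (n + 1) = ⊥) :
    CommRingCat.ofHom (Ideal.Quotient.mk (maximalIdeal (stalkAt T x) ^ (n + 1))) ≫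
        CommRingCat.ofHom (artinianFactor T x g hg hgK n hR).toRingHom =
      stalkHomOfPt T x g hg := by
  ext r
  rfl

/-- **(α7) `Spec φ_g ≫ (Spec(𝒪_{T,x}/𝔪^{n+1}) → T) = g`**: the `R`-point factors through the `n`-th
infinitesimal neighbourhood of `x`. [cite: StacksProject, Tag 01J6 (Schemes, Lemma 26.13.1)] [cite: GortzWedhorn2023, Prop. 27.208 (p. 685)] -/
theorem Spec_map_artinianFactor (g : Spec (CommRingCat.of R) ⟶ T.left) (hg : g (closedPoint R) = x.1)
    (hgK : g ≫ T.hom = Spec.map (CommRingCat.ofHom (algebraMap K R))) (n : ℕ)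
    (hR : maximalIdeal R ^ (n + 1) = ⊥) :
    Spec.map (CommRingCat.ofHom (artinianFactor T x g hg hgK n hR).toRingHom) ≫
      (thickeningPtι T x.1 n).left = g := by
  rw [thickeningPtι_left, ← Spec.map_comp_assoc, mk_comp_artinianFactor, Spec_map_stalkHomOfPt]

/-- **(α7, `Over` form)** the factorisation as a morphism of `K`-schemes
`specOver K R → thickeningPt T x n` over `T`. [cite: StacksProject, Tag 01J6 (Schemes, Lemma 26.13.1)] [cite: GortzWedhorn2023, Prop. 27.208 (p. 685)] -/
def artinianFactorOver (g : Spec (CommRingCat.of R) ⟶ T.left) (hg : g (closedPoint R) = x.1)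
    (hgK : g ≫ T.hom = Spec.map (CommRingCat.ofHom (algebraMap K R))) (n : ℕ)
    (hR : maximalIdeal R ^ (n + 1) = ⊥) : specOver K R ⟶ thickeningPt T x.1 n :=
  Over.homMk (Spec.map (CommRingCat.ofHom (artinianFactor T x g hg hgK n hR).toRingHom)) (by
    change Spec.map (CommRingCat.ofHom (artinianFactor T x g hg hgK n hR).toRingHom) ≫
        Spec.map (CommRingCat.ofHom (Ideal.Quotient.mk (maximalIdeal (stalkAt T x) ^ (n + 1)))) ≫
          T.left.fromSpecStalk x.1 ≫ T.hom =
      Spec.map (CommRingCat.ofHom (algebraMap K R))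
    rw [← Spec.map_comp_assoc, mk_comp_artinianFactor, ← Category.assoc, Spec_map_stalkHomOfPt]
    exact hgK)

/-- The scheme morphism underlying `artinianFactorOver` is `Spec φ_g`. [cite: StacksProject, Tag 01J6 (Schemes, Lemma 26.13.1)] [cite: GortzWedhorn2023, Prop. 27.208 (p. 685)] -/
@[simp] theorem artinianFactorOver_left (g : Spec (CommRingCat.of R) ⟶ T.left)
    (hg : g (closedPoint R) = x.1) (hgK : g ≫ T.hom = Spec.map (CommRingCat.ofHom (algebraMap K R)))
    (n : ℕ) (hR : maximalIdeal R ^ (n + 1) = ⊥) :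
    (artinianFactorOver T x g hg hgK n hR).left =
      Spec.map (CommRingCat.ofHom (artinianFactor T x g hg hgK n hR).toRingHom) :=
  rfl

/-- `artinianFactorOver ≫ thickeningPtι = g` (as morphisms of schemes). [cite: StacksProject, Tag 01J6 (Schemes, Lemma 26.13.1)] [cite: GortzWedhorn2023, Prop. 27.208 (p. 685)] -/
theorem artinianFactorOver_comp_ι_left (g : Spec (CommRingCat.of R) ⟶ T.left)
    (hg : g (closedPoint R) = x.1) (hgK : g ≫ T.hom = Spec.map (CommRingCat.ofHom (algebraMap K R)))
    (n : ℕ) (hR : maximalIdeal R ^ (n + 1) = ⊥) :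
    (artinianFactorOver T x g hg hgK n hR ≫ thickeningPtι T x.1 n).left = g :=
  Spec_map_artinianFactor T x g hg hgK n hR

/-- The `Over`-morphism form for a `K`-morphism `g : specOver K R → T`:
`artinianFactorOver ≫ thickeningPtι = g`. [cite: StacksProject, Tag 01J6 (Schemes, Lemma 26.13.1)] [cite: GortzWedhorn2023, Prop. 27.208 (p. 685)] -/
theorem artinianFactorOver_comp_ι (g : specOver K R ⟶ T) (hg : g.left (closedPoint R) = x.1)
    (n : ℕ) (hR : maximalIdeal R ^ (n + 1) = ⊥) :
    artinianFactorOver T x g.left hg (Over.w g) n hR ≫ thickeningPtι T x.1 n = g :=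
  Over.OverMorphism.ext (Spec_map_artinianFactor T x g.left hg (Over.w g) n hR)

omit [Algebra K R] in
/-- If `φ(r̄)` is a unit for a ring map `φ : 𝒪_{T,x}/𝔪^{n+1} → R` into a local ring, then `r` is a unit
(the maximal ideal of `𝒪/𝔪^{n+1}` is nil). [cite: GortzWedhorn2023, Lemma 24.72 (p. 409), proof, Steps (I)–(II) (p. 410)] -/
theorem isUnit_of_isUnit_map_mk (n : ℕ) (φ : thickRing T x n →+* R) (r : stalkAt T x)
    (h : IsUnit (φ (Ideal.Quotient.mk _ r))) : IsUnit r := by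
  by_contra hru
  have hr : r ∈ maximalIdeal (stalkAt T x) := (IsLocalRing.mem_maximalIdeal r).mpr hru
  have h0 : φ (Ideal.Quotient.mk _ r) ^ (n + 1) = 0 := by
    rw [← map_pow, ← map_pow, Ideal.Quotient.eq_zero_iff_mem.mpr (Ideal.pow_mem_pow hr _), map_zero]
  exact not_isUnit_zero (h0 ▸ h.pow (n + 1))

omit [Algebra K R] in
/-- A ring map out of `𝒪_{T,x}/𝔪^{n+1}` into a local ring is local. [cite: GortzWedhorn2023, Lemma 24.72 (p. 409), proof, Steps (I)–(II) (p. 410)] -/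
theorem isLocalHom_of_thickRing (n : ℕ) (φ : thickRing T x n →+* R) : IsLocalHom φ := by
  refine ⟨fun a ha => ?_⟩
  obtain ⟨r, rfl⟩ := Ideal.Quotient.mk_surjective a
  exact (isUnit_of_isUnit_map_mk T x n φ r ha).map _

/-- **(α7) Uniqueness of the factorisation**: a `K`-algebra map `φ : 𝒪_{T,x}/𝔪^{n+1} → R` with
`Spec φ ≫ (Spec(𝒪/𝔪^{n+1}) → T) = g` is `artinianFactor` (Mathlib `SpecToEquivOfLocalRing`).
[cite: StacksProject, Tag 01J6 (Schemes, Lemma 26.13.1)] [cite: GortzWedhorn2023, Prop. 27.208 (p. 685)] -/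
theorem artinianFactor_unique (g : Spec (CommRingCat.of R) ⟶ T.left) (hg : g (closedPoint R) = x.1)
    (hgK : g ≫ T.hom = Spec.map (CommRingCat.ofHom (algebraMap K R))) (n : ℕ)
    (hR : maximalIdeal R ^ (n + 1) = ⊥) (φ : thickRing T x n →ₐ[K] R)
    (hφ : Spec.map (CommRingCat.ofHom φ.toRingHom) ≫ (thickeningPtι T x.1 n).left = g) :
    φ = artinianFactor T x g hg hgK n hR := by
  -- both composites `𝒪_{T,x} → R` give `g`; compare them through `SpecToEquivOfLocalRing`
  set ψ₁ : T.left.presheaf.stalk x.1 ⟶ CommRingCat.of R :=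
    CommRingCat.ofHom (Ideal.Quotient.mk (maximalIdeal (stalkAt T x) ^ (n + 1))) ≫
      CommRingCat.ofHom φ.toRingHom with hψ₁
  have hloc₁ : IsLocalHom ψ₁.hom := ⟨fun r hr => isUnit_of_isUnit_map_mk T x n φ.toRingHom r hr⟩
  have hloc₂ : IsLocalHom (stalkHomOfPt T x g hg).hom := isLocalHom_stalkHomOfPt T x g hg
  have h₁ : Spec.map ψ₁ ≫ T.left.fromSpecStalk x.1 = g := by
    rw [hψ₁, Spec.map_comp, Category.assoc]
    exact hφ
  have h₂ : Spec.map (stalkHomOfPt T x g hg) ≫ T.left.fromSpecStalk x.1 = g :=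
    Spec_map_stalkHomOfPt T x g hg
  have heq : (⟨x.1, ψ₁, hloc₁⟩ :
      Σ y, { f : T.left.presheaf.stalk y ⟶ CommRingCat.of R // IsLocalHom f.hom }) =
      ⟨x.1, stalkHomOfPt T x g hg, hloc₂⟩ := by
    apply (SpecToEquivOfLocalRing T.left (CommRingCat.of R)).symm.injective
    change Spec.map ψ₁ ≫ T.left.fromSpecStalk x.1 = Spec.map (stalkHomOfPt T x g hg) ≫ T.left.fromSpecStalk x.1
    rw [h₁, h₂]
  have hψ : ψ₁ = stalkHomOfPt T x g hg :=
    congrArg Subtype.val (eq_of_heq (Sigma.mk.inj_iff.mp heq).2)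
  refine Ideal.Quotient.algHom_ext _ (AlgHom.ext fun r => ?_)
  change ψ₁.hom r = (stalkHomOfPt T x g hg).hom r
  rw [hψ]

end ArtinianPoints

/-! ## §4b (α7′) The thickening rings as Artinian local `K`-algebras; extensionality of chart points -/

section ThickRingLocal

variable {K : Type u} [Field K] (T : SchemeOver K) {B : T.left.Opens} (x : B)

/-- `𝒪_{T,x}/𝔪^{n+1}` is nontrivial (`𝔪^{n+1} ≤ 𝔪 ≠ ⊤`). [cite: GortzWedhorn2023, Lemma 24.72 (p. 409), proof, Steps (I)–(II) (p. 410)] -/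
theorem nontrivial_thickRing (n : ℕ) : Nontrivial (thickRing T x n) :=
  Ideal.Quotient.nontrivial_iff.mpr fun h =>
    (maximalIdeal.isMaximal (stalkAt T x)).ne_top (top_le_iff.mp (h ▸ pow_le T x n))

/-- **`𝒪_{T,x}/𝔪^{n+1}` is a local ring** (quotient of a local ring; Mathlib `IsLocalRing.of_surjective'`).
A `theorem`, not an instance: consumers write `haveI := isLocalRing_thickRing T x n`; the lemmas below take the
instance as a hypothesis `[IsLocalRing (thickRing T x n)]`.
[cite: GortzWedhorn2023, Lemma 24.72 (p. 409), proof, Steps (I)–(II) (p. 410)] -/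
theorem isLocalRing_thickRing (n : ℕ) : IsLocalRing (thickRing T x n) :=
  haveI := nontrivial_thickRing T x n
  IsLocalRing.of_surjective' (Ideal.Quotient.mk _) Ideal.Quotient.mk_surjective

/-- The maximal ideal of `𝒪_{T,x}/𝔪^{n+1}` is `𝔪/𝔪^{n+1}`. [cite: GortzWedhorn2023, Lemma 24.72 (p. 409), proof, Steps (I)–(II) (p. 410)] -/
theorem maximalIdeal_thickRing (n : ℕ) [IsLocalRing (thickRing T x n)] :
    maximalIdeal (thickRing T x n) = (maximalIdeal (stalkAt T x)).map (Ideal.Quotient.mk _) :=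
  (map_maximalIdeal_of_surjective (Ideal.Quotient.mk (maximalIdeal (stalkAt T x) ^ (n + 1)))
    Ideal.Quotient.mk_surjective).symm

/-- **`(𝔪/𝔪^{n+1})^{n+1} = 0`**: the hypothesis `hR` of `artinianFactor` holds for `R := 𝒪_{T,x}/𝔪^{n+1}`
itself (and a fortiori `(𝔪/𝔪^{n+1})^{m+1} = 0` for `m ≥ n`). [cite: GortzWedhorn2023, Lemma 24.72 (p. 409), proof, Steps (I)–(II) (p. 410)] -/
theorem maximalIdeal_thickRing_pow_eq_bot (n : ℕ) [IsLocalRing (thickRing T x n)] :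
    maximalIdeal (thickRing T x n) ^ (n + 1) = ⊥ := by
  rw [maximalIdeal_thickRing, ← Ideal.map_pow, Ideal.map_quotient_self]

/-- `(𝔪/𝔪^{n+1})^{m+1} = 0` for `n ≤ m`. [cite: GortzWedhorn2023, Lemma 24.72 (p. 409), proof, Steps (I)–(II) (p. 410)] -/
theorem maximalIdeal_thickRing_pow_eq_bot_of_le {n m : ℕ} [IsLocalRing (thickRing T x n)] (h : n ≤ m) :
    maximalIdeal (thickRing T x n) ^ (m + 1) = ⊥ :=
  le_bot_iff.mp ((Ideal.pow_le_pow_right (Nat.succ_le_succ h)).trans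
    (maximalIdeal_thickRing_pow_eq_bot T x n).le)

/-- The thickening `Spec(𝒪_{T,x}/𝔪^{n+1}) → T` is centred at `x` (every point goes to `x`; the tree's
`thickeningPtι_left_apply`). [cite: GortzWedhorn2023, Lemma 24.72 (p. 409), proof, Steps (I)–(II) (p. 410)] -/
theorem thickeningPtι_closedPoint (n : ℕ) [IsLocalRing (thickRing T x n)] :
    (thickeningPtι T x.1 n).left (closedPoint (thickRing T x n)) = x.1 :=
  thickeningPtι_left_apply T x.1 n _

/-- `π_n : 𝒪/𝔪^{n+2} → 𝒪/𝔪^{n+1}` is a local homomorphism. [cite: GortzWedhorn2023, Lemma 24.72 (p. 409), proof, Steps (I)–(II) (p. 410)] -/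
theorem isLocalHom_thickπ (n : ℕ) [IsLocalRing (thickRing T x n)] : IsLocalHom (thickπ T x n).toRingHom :=
  isLocalHom_of_thickRing T x (n + 1) _

/-- `Spec π_n` maps the closed point to the closed point. [cite: GortzWedhorn2023, Lemma 24.72 (p. 409), proof, Steps (I)–(II) (p. 410)] -/
theorem Spec_map_thickπ_closedPoint (n : ℕ) [IsLocalRing (thickRing T x n)]
    [IsLocalRing (thickRing T x (n + 1))] :
    Spec.map (CommRingCat.ofHom (thickπ T x n).toRingHom) (closedPoint (thickRing T x n)) =
      closedPoint (thickRing T x (n + 1)) :=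
  haveI := isLocalHom_thickπ T x n
  Spec_closedPoint

variable {R : Type u} [CommRing R] [IsLocalRing R] [Algebra K R]

omit [Algebra K R] in
/-- The `R`-point `Spec φ ≫ (Spec(𝒪/𝔪^{n+1}) → T)` of a chart point `φ : 𝒪_{T,x}/𝔪^{n+1} → R` is centred
at `x`. [cite: StacksProject, Tag 01J6 (Schemes, Lemma 26.13.1)] -/
theorem Spec_map_comp_thickeningPtι_closedPoint (n : ℕ) (φ : thickRing T x n →+* R) :
    (Spec.map (CommRingCat.ofHom φ) ≫ (thickeningPtι T x.1 n).left) (closedPoint R) = x.1 :=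
  thickeningPtι_left_apply T x.1 n _

omit [IsLocalRing R] in
/-- The `R`-point of a `K`-algebra chart point is a `K`-morphism. [cite: StacksProject, Tag 01J6 (Schemes, Lemma 26.13.1)] -/
theorem Spec_map_comp_thickeningPtι_comp_hom (n : ℕ) (φ : thickRing T x n →ₐ[K] R) :
    (Spec.map (CommRingCat.ofHom φ.toRingHom) ≫ (thickeningPtι T x.1 n).left) ≫ T.hom =
      Spec.map (CommRingCat.ofHom (algebraMap K R)) := by
  change (Spec.map (CommRingCat.ofHom φ.toRingHom) ≫
      (Spec.map (CommRingCat.ofHom (Ideal.Quotient.mk (maximalIdeal (stalkAt T x) ^ (n + 1)))) ≫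
        T.left.fromSpecStalk x.1)) ≫ T.hom = Spec.map (CommRingCat.ofHom (algebraMap K R))
  rw [Category.assoc, Category.assoc, ← Spec_map_algebraMap_stalkAt, ← Spec.map_comp, ← Spec.map_comp]
  congr 1
  ext c
  exact φ.commutes c

/-- A chart point `φ : 𝒪_{T,x}/𝔪^{n+1} → R` IS the Artinian factorisation of its own `R`-point
`Spec φ ≫ (Spec(𝒪/𝔪^{n+1}) → T)`. [cite: StacksProject, Tag 01J6 (Schemes, Lemma 26.13.1)] [cite: GortzWedhorn2023, Prop. 27.208 (p. 685)] -/
theorem eq_artinianFactor (n : ℕ) (hR : maximalIdeal R ^ (n + 1) = ⊥) (φ : thickRing T x n →ₐ[K] R) :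
    φ = artinianFactor T x (Spec.map (CommRingCat.ofHom φ.toRingHom) ≫ (thickeningPtι T x.1 n).left)
      (Spec_map_comp_thickeningPtι_closedPoint T x n φ.toRingHom)
      (Spec_map_comp_thickeningPtι_comp_hom T x n φ) n hR :=
  artinianFactor_unique T x _ _ _ n hR φ rfl

/-- **(α7′) EXTENSIONALITY OF CHART POINTS**: two `K`-algebra maps `φ₁, φ₂ : 𝒪_{T,x}/𝔪^{n+1} → R` into a
local `K`-algebra with `𝔪_R^{n+1} = 0` are equal as soon as their `R`-points
`Spec φᵢ ≫ (Spec(𝒪/𝔪^{n+1}) → T)` agree (e.g. `π_n ∘ φ' = φ ∘ β_n` in the lift step of a tower).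
[cite: StacksProject, Tag 01J6 (Schemes, Lemma 26.13.1)] [cite: GortzWedhorn2023, Prop. 27.208 (p. 685)] -/
theorem algHom_thickRing_ext (n : ℕ) (hR : maximalIdeal R ^ (n + 1) = ⊥)
    (φ₁ φ₂ : thickRing T x n →ₐ[K] R)
    (h : Spec.map (CommRingCat.ofHom φ₁.toRingHom) ≫ (thickeningPtι T x.1 n).left =
      Spec.map (CommRingCat.ofHom φ₂.toRingHom) ≫ (thickeningPtι T x.1 n).left) : φ₁ = φ₂ :=
  (artinianFactor_unique T x _ (Spec_map_comp_thickeningPtι_closedPoint T x n φ₂.toRingHom)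
      (Spec_map_comp_thickeningPtι_comp_hom T x n φ₂) n hR φ₁ h).trans
    (eq_artinianFactor T x n hR φ₂).symm

end ThickRingLocal

end Literature.AlgebraicGeometry.Motives

end
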